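import Literature.NumberTheory.IwasawaTheory.ImaginaryQuadraticTwoTowerDyadicCapitulation
import Literature.NumberTheory.IwasawaTheory.ImaginaryQuadraticTwoTowerLambdaOfRootsOfUnity
import Literature.NumberTheory.EllipticCurves.FineSelmerClassGroupPRankBoundedProofs
import HarnessLib

/-!
# Growth lower bound in the `2`-ramified tower: capitulation kernel of order `≤ 2` forces `e_{n+2} + 1 ≥ e_{n+1} + rank₂ Cl(K_{n+1})`, hence
# `rank₂ Cl(K_m) ≤ λ₂ + 1` for `m ≫ 0`, for `K = ℚ(√−d)`, `d ≡ 1 (mod 4)` (proved; no definition, no named fact)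

Topic `NumberTheory/IwasawaTheory` (namespace = path).  THEOREM-ONLY file, written by the prover seat `bsd-line-att-p3` g32 (cell `bsd-f1-sign2`; `--supports`
stmt-BirchSwinnertonDyer-22298; closes nothing).  Sequel of `ClassicalLambdaGeRankOfNoCapitulation` (g31: NO capitulation ⟹ `e_{n+1} + r_{n+1} ≤ e_{n+2}`) and
`ImaginaryQuadraticTwoTowerDyadicCapitulation` (capitulation kernel `⊆ {1, [𝔓_{n+1}]}` in the `2`-ramified tower).

* §1 `DyadicCapitulation.card_mul_card_quotient_dvd_two_mul_card` — the algebra: `N : B ↠ A`, `j : A → B` with `ker j ⊆ {1, a₀}`, `g_i` endomorphisms of `B` with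
  `N ∘ g_i = N`, `j (N b) = ∏_i g_i b`, `d ∣ #ι` ⟹ **`#A · #(A/A^d) ∣ 2 · #B`** (`im(j ∘ N) = j(A)` has order `#A / #ker j ≥ #A/2` and lies in `B^d · I`, while
  `B/(B^d·I) ↠ A/A^d`, exactly as in g31's brick); `padicValNat_card_add_le_succ` (`p = 2`: `ord₂ #A + rank₂ A ≤ ord₂ #B + 1`).
* §2 `eq_one_or_eq_mk0_of_classGroupExtend_eq_one_of_ringEquiv` — transport of «capitulation kernel `⊆ {1, [𝔓]}`» along compatible ring isomorphisms of a pair,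
  the dyadic prime being characterised as the unique prime containing `2`.
* §3 ★ `classNumberPExp_add_classGroupPRank_le_succ_of_sq_eq_neg` — `K ∋ √−d`, `d ≡ 1 (mod 4)` squarefree, `d ≠ 1`, `κ₀ = (ℚ_∞)|_K`:
  **`e_{n+1} + rank₂ Cl(K_{n+1}) ≤ e_{n+2} + 1`** for every `n`.
* §4 ★ `exists_forall_classGroupPRank_le_classicalLambda_add_one` — for EVERY cyclotomic `ℤ₂`-extension `κK` of such `K`: `μ = 0` and
  **`rank₂ Cl(K_m) ≤ classicalLambda κK + 1` for all `m ≫ 0`** (with the tree's `λ ≤ rank₂ Cl(K_m)`: `λ₂ ∈ {r − 1, r}`, `r` the eventual `2`-rank; Ferrero–Kida: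
  `λ₂ = r − 1`).

References: [Ferrero1980AJM] §3; [Kida1979Tohoku] Thm. 1; [Schettler2014] Thm. 8, Rem. 9; [Washington1997] §13.3 Prop. 13.22–13.28, Thm. 13.13; [NeukirchANT1999] Ch. III §1 (1.6).
-/

set_option autoImplicit false

noncomputable section

open scoped NumberField nonZeroDivisors

/-! ## §1 Finite commutative groups: `#A · #(A/A^d) ∣ 2 · #B` when `ker j ⊆ {1, a₀}` -/

namespace Literature.NumberTheory.IwasawaTheory.DyadicCapitulation

section Algebra

variable {A B : Type*} [CommGroup A] [Finite A] [CommGroup B] [Finite B]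

omit [Finite B] in
/-- `∏_i g_i b = b^{#ι} · ∏_i (g_i b / b)` in a commutative group. [folklore] -/
private theorem prod_apply_eq_pow_mul_prod_div {ι : Type*} [Fintype ι] (g : ι → B →* B) (b : B) :
    ∏ i, g i b = b ^ Fintype.card ι * ∏ i, (g i b / b) := by
  have hb : b ^ Fintype.card ι = ∏ _i : ι, b := by rw [Finset.prod_const, Finset.card_univ]
  rw [hb, ← Finset.prod_mul_distrib]
  exact Finset.prod_congr rfl fun i _ => by rw [mul_comm, div_mul_cancel]

omit [Finite A] [Finite B] in
/-- A surjection of groups induces `#(A ⧸ H') ∣ [B : H]` whenever `H ≤ f⁻¹ H'`. [folklore] -/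
private theorem card_quotient_dvd_index_of_le_comap (f : B →* A) (hf : Function.Surjective f) (H : Subgroup B) (H' : Subgroup A)
    (hle : H ≤ H'.comap f) : Nat.card (A ⧸ H') ∣ H.index := by
  set φ : B →* A ⧸ H' := (QuotientGroup.mk' H').comp f with hφ
  have hφs : Function.Surjective φ := (QuotientGroup.mk'_surjective H').comp hf
  have hker : H ≤ φ.ker := fun b hb => by
    rw [MonoidHom.mem_ker, hφ, MonoidHom.comp_apply, QuotientGroup.mk'_apply, QuotientGroup.eq_one_iff]
    exact hle hb
  have h1 : φ.ker.index = Nat.card (A ⧸ H') := by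
    rw [Subgroup.index_ker, MonoidHom.range_eq_top.mpr hφs, Subgroup.card_top]
  rw [← h1]
  exact Subgroup.index_dvd_of_le hker

omit [Finite B] in
/-- A subgroup contained in `{1, a₀}` has order dividing `2`. [folklore] -/
private theorem card_dvd_two_of_subset (H : Subgroup A) (a₀ : A) (h : ∀ a ∈ H, a = 1 ∨ a = a₀) : Nat.card H ∣ 2 := by
  classical
  have hle : Nat.card H ≤ 2 := by
    have hsub : (H : Set A) ⊆ {1, a₀} := fun a ha => by
      rcases h a ha with h1 | h1
      · rw [h1]; exact Set.mem_insert _ _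
      · rw [h1]; exact Set.mem_insert_of_mem _ rfl
    calc Nat.card H = (H : Set A).ncard := Nat.card_coe_set_eq (H : Set A)
      _ ≤ ({1, a₀} : Set A).ncard := Set.ncard_le_ncard hsub (Set.toFinite _)
      _ ≤ ({a₀} : Set A).ncard + 1 := Set.ncard_insert_le 1 {a₀}
      _ = 2 := by rw [Set.ncard_singleton]
  have hpos : 0 < Nat.card H := Nat.card_pos
  have h12 : Nat.card H = 1 ∨ Nat.card H = 2 := by omega
  rcases h12 with h1 | h1 <;> simp [h1]

omit [Finite B] in
/-- ★ **`#A · #(A/A^d) ∣ 2 · #B`.**  `N : B → A` onto, `j : A → B` with `ker j ⊆ {1, a₀}`, `g_i` (`i ∈ ι`, finite) endomorphisms of `B` with `N (g_i b) = N b` and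
`j (N b) = ∏_i g_i b`, `d ∣ #ι`.  Then `#A · #(A ⧸ A^d) ∣ 2 · #B`: `im(j∘N) = j(A) ≤ B^d·I` has order `#A/#ker j` with `#ker j ∣ 2`, and `B/(B^d·I) ↠ A/A^d` (g31's brick
`NoCapitulation.card_mul_card_quotient_dvd_card` with a kernel of order `≤ 2`). [cite: Washington1997, §13.3 (proof of Prop. 13.22–13.23, Prop. 13.26)]
[cite: NeukirchANT1999, Ch. III §1 Prop. (1.6) (ii), (iv)] -/
theorem card_mul_card_quotient_dvd_two_mul_card {ι : Type*} [Fintype ι] (N : B →* A) (j : A →* B) (g : ι → B →* B) {d : ℕ}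
    (hN : Function.Surjective N) (a₀ : A) (hker : ∀ a, j a = 1 → a = 1 ∨ a = a₀) (hNg : ∀ i b, N (g i b) = N b) (hjN : ∀ b, j (N b) = ∏ i, g i b)
    (hd : d ∣ Fintype.card ι) :
    Nat.card A * Nat.card (A ⧸ (powMonoidHom d : A →* A).range) ∣ 2 * Nat.card B := by
  classical
  set I : Subgroup B := Subgroup.closure {x | ∃ (i : ι) (b : B), x = g i b / b} with hI
  set H : Subgroup B := (powMonoidHom d : B →* B).range ⊔ I with hH
  -- (1) `range (j ∘ N) ≤ H`
  have hrange : (j.comp N).range ≤ H := by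
    rintro _ ⟨b, rfl⟩
    rw [MonoidHom.comp_apply, hjN b, prod_apply_eq_pow_mul_prod_div g b]
    obtain ⟨m, hm⟩ := hd
    refine Subgroup.mul_mem _ (Subgroup.mem_sup_left ⟨b ^ m, ?_⟩) (Subgroup.mem_sup_right ?_)
    · rw [powMonoidHom_apply, ← pow_mul, mul_comm, ← hm]
    · exact Subgroup.prod_mem _ fun i _ => Subgroup.subset_closure ⟨i, b, rfl⟩
  -- (2) `#range (j ∘ N) · #ker j = #A`, `#ker j ∣ 2`
  have hcardr : Nat.card (j.comp N).range * Nat.card j.ker = Nat.card A := by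
    rw [MonoidHom.range_comp, MonoidHom.range_eq_top.mpr hN, ← MonoidHom.range_eq_map,
      ← Nat.card_congr (QuotientGroup.quotientKerEquivRange j).toEquiv]
    exact (Subgroup.card_eq_card_quotient_mul_card_subgroup j.ker).symm
  have hker2 : Nat.card j.ker ∣ 2 := card_dvd_two_of_subset j.ker a₀ fun a ha => hker a (MonoidHom.mem_ker.mp ha)
  have hA : Nat.card A ∣ 2 * Nat.card H := by
    rw [← hcardr, mul_comm 2]
    exact mul_dvd_mul (Subgroup.card_dvd_of_le hrange) hker2
  -- (3) `#(A/A^d) ∣ [B : H]`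
  have hq : Nat.card (A ⧸ (powMonoidHom d : A →* A).range) ∣ H.index := by
    refine card_quotient_dvd_index_of_le_comap N hN H _ (sup_le ?_ ?_)
    · rintro _ ⟨b, rfl⟩
      exact ⟨N b, by rw [powMonoidHom_apply, powMonoidHom_apply, map_pow]⟩
    · rw [hI, Subgroup.closure_le]
      rintro _ ⟨i, b, rfl⟩
      simp only [SetLike.mem_coe, Subgroup.mem_comap, map_div, hNg i b, div_self']
      exact one_mem _
  -- (4) multiply
  have hB : 2 * Nat.card B = 2 * Nat.card H * H.index := by rw [mul_assoc, Subgroup.card_mul_index H]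
  rw [hB]
  exact mul_dvd_mul hA hq

/-- The `2`-adic reading (`d = p = 2`): **`ord₂ #A + ord₂ #(A/A²) ≤ ord₂ #B + 1`** (`ord₂ #(A/A²) = rank₂ A`). [cite: Washington1997, §13.3 (proof of Prop. 13.23)] -/
theorem padicValNat_card_add_le_succ {ι : Type*} [Fintype ι] (N : B →* A) (j : A →* B) (g : ι → B →* B)
    (hN : Function.Surjective N) (a₀ : A) (hker : ∀ a, j a = 1 → a = 1 ∨ a = a₀) (hNg : ∀ i b, N (g i b) = N b) (hjN : ∀ b, j (N b) = ∏ i, g i b)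
    (hd : 2 ∣ Fintype.card ι) :
    padicValNat 2 (Nat.card A) + padicValNat 2 (Nat.card (A ⧸ (powMonoidHom 2 : A →* A).range)) ≤ padicValNat 2 (Nat.card B) + 1 := by
  haveI : Fact (Nat.Prime 2) := ⟨Nat.prime_two⟩
  have h := card_mul_card_quotient_dvd_two_mul_card N j g hN a₀ hker hNg hjN hd
  have hA : Nat.card A ≠ 0 := Nat.card_pos.ne'
  have hQ : Nat.card (A ⧸ (powMonoidHom 2 : A →* A).range) ≠ 0 := Nat.card_pos.ne'
  have hB : Nat.card B ≠ 0 := Nat.card_pos.ne'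
  rw [← padicValNat.mul hA hQ]
  have h2 : padicValNat 2 (2 * Nat.card B) = padicValNat 2 (Nat.card B) + 1 := by
    rw [padicValNat.mul two_ne_zero hB, padicValNat.self (by norm_num)]; ring
  rw [← h2]
  exact (padicValNat_dvd_iff_le (mul_ne_zero two_ne_zero hB)).mp (dvd_trans pow_padicValNat_dvd h)

end Algebra

end Literature.NumberTheory.IwasawaTheory.DyadicCapitulation

/-! ## §2 Transport of «capitulation kernel `⊆ {1, [𝔓]}`» along an isomorphism of pairs -/

namespace Literature.NumberTheory.IwasawaTheory

open NumberField IsDedekindDomain Field IntermediateField Module Ideal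
open Literature.NumberTheory.EllipticCurves Literature.NumberTheory.EllipticCurves.ZpExtension
  Literature.NumberTheory.GaloisRepresentations Literature.NumberTheory.NumberFields

section Transport

variable {M L M' L' : Type} [Field M] [NumberField M] [Field L] [NumberField L] [Algebra M L]
  [Field M'] [NumberField M'] [Field L'] [NumberField L'] [Algebra M' L']

/-- **Transport of the capitulation kernel.**  `eM : M ≃ M'`, `eL : L ≃ L'` compatible ring isomorphisms of the pairs `M ⊆ L`, `M' ⊆ L'`; `𝔓` a prime of `M` containing `2`
such that every capitulating class of `M` is `1` or `[𝔓]`; `𝔓'` the ONLY prime of `M'` containing `2`.  Then every capitulating class of `M'` is `1` or `[𝔓']`.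
[cite: NeukirchANT1999, Ch. III §1 Prop. (1.6)] -/
theorem eq_one_or_eq_mk0_of_classGroupExtend_eq_one_of_ringEquiv (eM : M ≃+* M') (eL : L ≃+* L')
    (hcomp : ∀ x : M, eL (algebraMap M L x) = algebraMap M' L' (eM x))
    (𝔓 : HeightOneSpectrum (𝓞 M)) (h2 : (2 : 𝓞 M) ∈ 𝔓.asIdeal)
    (h : ∀ c : ClassGroup (𝓞 M), classGroupExtend M L c = 1 → c = 1 ∨ c = ClassGroup.mk0 ⟨𝔓.asIdeal, mem_nonZeroDivisors_of_ne_zero 𝔓.ne_bot⟩)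
    (𝔓' : HeightOneSpectrum (𝓞 M')) (huniq' : ∀ Q : HeightOneSpectrum (𝓞 M'), (2 : 𝓞 M') ∈ Q.asIdeal → Q = 𝔓')
    {c' : ClassGroup (𝓞 M')} (hc' : classGroupExtend M' L' c' = 1) :
    c' = 1 ∨ c' = ClassGroup.mk0 ⟨𝔓'.asIdeal, mem_nonZeroDivisors_of_ne_zero 𝔓'.ne_bot⟩ := by
  classical
  obtain ⟨⟨𝔞', h𝔞'⟩, rfl⟩ := ClassGroup.mk0_surjective c'
  have h𝔞'0 : 𝔞' ≠ ⊥ := nonZeroDivisors.ne_zero h𝔞'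
  set fM : 𝓞 M ≃+* 𝓞 M' := RingOfIntegers.mapRingEquiv eM with hfM
  set fL : 𝓞 L ≃+* 𝓞 L' := RingOfIntegers.mapRingEquiv eL with hfL
  have hsq : (algebraMap (𝓞 M') (𝓞 L')).comp (fM : 𝓞 M →+* 𝓞 M') = (fL : 𝓞 L →+* 𝓞 L').comp (algebraMap (𝓞 M) (𝓞 L)) := by
    ext x
    change algebraMap M' L' (eM (x : M)) = eL (algebraMap M L (x : M))
    rw [hcomp]
  -- pull `𝔞'` back to `M`
  set 𝔞 : Ideal (𝓞 M) := 𝔞'.comap (fM : 𝓞 M →+* 𝓞 M') with h𝔞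
  have h𝔞map : 𝔞.map (fM : 𝓞 M →+* 𝓞 M') = 𝔞' := Ideal.map_comap_of_surjective _ fM.surjective 𝔞'
  have h𝔞0 : 𝔞 ≠ ⊥ := by
    intro h0; apply h𝔞'0
    rw [← h𝔞map, h0, Ideal.map_bot]
  -- `𝔞 𝓞_L` is principal
  rw [classGroupExtend_mk0, ClassGroup.mk0_eq_one_iff] at hc'
  obtain ⟨x', hx'⟩ := hc'
  have hx'' : (𝔞'.map (algebraMap (𝓞 M') (𝓞 L'))) = Ideal.span {x'} := hx'
  have hprin : (𝔞.map (algebraMap (𝓞 M) (𝓞 L))).IsPrincipal := by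
    have h1 : (𝔞.map (algebraMap (𝓞 M) (𝓞 L))).map (fL : 𝓞 L →+* 𝓞 L') = Ideal.span {x'} := by
      rw [Ideal.map_map, ← hsq, ← Ideal.map_map, h𝔞map, hx'']
    have h3 : (Ideal.span {fL.symm x'} : Ideal (𝓞 L)).map (fL : 𝓞 L →+* 𝓞 L') = Ideal.span {x'} := by
      rw [Ideal.map_span, Set.image_singleton]
      change Ideal.span {fL (fL.symm x')} = _
      rw [RingEquiv.apply_symm_apply]
    have h2' : 𝔞.map (algebraMap (𝓞 M) (𝓞 L)) = Ideal.span {fL.symm x'} := by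
      have e1 := Ideal.comap_map_of_bijective (fL : 𝓞 L →+* 𝓞 L') fL.bijective (I := 𝔞.map (algebraMap (𝓞 M) (𝓞 L)))
      have e2 := Ideal.comap_map_of_bijective (fL : 𝓞 L →+* 𝓞 L') fL.bijective (I := (Ideal.span {fL.symm x'} : Ideal (𝓞 L)))
      rw [h1] at e1
      rw [h3] at e2
      rw [← e1, e2]
    rw [h2']
    exact ⟨⟨_, rfl⟩⟩
  have hc : classGroupExtend M L (ClassGroup.mk0 ⟨𝔞, mem_nonZeroDivisors_of_ne_zero h𝔞0⟩) = 1 := by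
    rw [classGroupExtend_mk0, ClassGroup.mk0_eq_one_iff]; exact hprin
  rcases h _ hc with h1 | h1
  · -- `𝔞` principal ⟹ `𝔞'` principal
    left
    rw [ClassGroup.mk0_eq_one_iff] at h1 ⊢
    obtain ⟨y, hy⟩ := h1
    have hy' : 𝔞 = Ideal.span {y} := hy
    change (𝔞' : Ideal (𝓞 M')).IsPrincipal
    rw [← h𝔞map, hy', Ideal.map_span, Set.image_singleton]
    exact ⟨⟨_, rfl⟩⟩
  · -- `𝔞 ~ 𝔓` ⟹ `𝔞' ~ fM(𝔓) = 𝔓'`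
    right
    rw [ClassGroup.mk0_eq_mk0_iff] at h1 ⊢
    obtain ⟨x, y, hx, hy, hxy⟩ := h1
    -- `fM(𝔓)` is the dyadic prime of `M'`
    haveI := 𝔓.isMaximal
    have hPmax : (𝔓.asIdeal.map (fM : 𝓞 M →+* 𝓞 M')).IsMaximal := by
      rw [Ideal.map_comap_of_equiv]
      exact Ideal.comap_isMaximal_of_surjective _ fM.symm.surjective
    have hP0 : 𝔓.asIdeal.map (fM : 𝓞 M →+* 𝓞 M') ≠ ⊥ := fun h0 =>
      𝔓.ne_bot ((Ideal.map_eq_bot_iff_of_injective (f := (fM : 𝓞 M →+* 𝓞 M')) fM.injective).mp h0)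
    set P' : HeightOneSpectrum (𝓞 M') := ⟨_, hPmax.isPrime, hP0⟩
    have hP' : P' = 𝔓' := huniq' P' (by
      change (2 : 𝓞 M') ∈ 𝔓.asIdeal.map (fM : 𝓞 M →+* 𝓞 M')
      have := Ideal.mem_map_of_mem (fM : 𝓞 M →+* 𝓞 M') h2
      rwa [map_ofNat] at this)
    refine ⟨fM x, fM y, (map_ne_zero_iff _ fM.injective).mpr hx, (map_ne_zero_iff _ fM.injective).mpr hy, ?_⟩
    have := congrArg (Ideal.map (fM : 𝓞 M →+* 𝓞 M')) hxy
    rw [Ideal.map_mul, Ideal.map_mul, Ideal.map_span, Set.image_singleton, Ideal.map_span, Set.image_singleton] at this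
    change Ideal.span {fM x} * 𝔞.map (fM : 𝓞 M →+* 𝓞 M') = Ideal.span {fM y} * 𝔓.asIdeal.map (fM : 𝓞 M →+* 𝓞 M') at this
    rw [h𝔞map] at this
    have hPI : 𝔓.asIdeal.map (fM : 𝓞 M →+* 𝓞 M') = 𝔓'.asIdeal := congrArg HeightOneSpectrum.asIdeal hP'
    rw [this, hPI]

end Transport

/-! ## §3 The tower `K·ℚ_∞ / K`, `K ∋ √−d`, `d ≡ 1 (mod 4)`: `e_{n+1} + r_{n+1} ≤ e_{n+2} + 1` -/

section Tower

variable (K : Type) [Field K] [NumberField K]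

/-- ★ **`e_{n+1} + rank₂ Cl(K_{n+1}) ≤ e_{n+2} + 1` in the cyclotomic `ℤ₂`-tower of `K ∋ √−d`, `d ≡ 1 (mod 4)` squarefree, `d ≠ 1`** (`κ₀ = (ℚ_∞)|_K`, `e_m = ord₂ h(K_m)`):
the capitulation kernel of `Cl(K_{n+1}) → Cl(K_{n+2})` is `⊆ {1, [𝔓_{n+1}]}` (tree `dyadicCapitulation_fieldRange_sup_layer`, transported to the layers of `κ₀`), `N` is onto
(Fukuda index `0`), `#Gal = 2`, `i ∘ N = Σ_σ σ`, and §1. [cite: Ferrero1980AJM, §3] [cite: Washington1997, §13.3 Prop. 13.22 and Prop. 13.26] -/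
theorem classNumberPExp_add_classGroupPRank_le_succ_of_sq_eq_neg (hK2 : Module.finrank ℚ K = 2) {d : ℕ} (hsf : Squarefree d) (hd4 : d % 4 = 1) (hd1 : d ≠ 1)
    (hη : ∃ η : K, η ^ 2 = -((d : ℕ) : K))
    (h : Function.Surjective ((CyclotomicZp.zpExtension 2).toContinuousMonoidHom.comp (absGaloisRestrict ℚ K))) (n : ℕ) :
    haveI : Fact (Nat.Prime 2) := ⟨Nat.prime_two⟩
    classNumberPExp ((CyclotomicZp.zpExtension 2).restrict K h) (n + 1) + classGroupPRank ((CyclotomicZp.zpExtension 2).restrict K h) (n + 1) ≤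
      classNumberPExp ((CyclotomicZp.zpExtension 2).restrict K h) (n + 2) + 1 := by
  classical
  haveI : Fact (Nat.Prime 2) := ⟨Nat.prime_two⟩
  set κ := CyclotomicZp.zpExtension 2 with hκdef
  have hcyc : κ.IsCyclotomic := CyclotomicZp.isCyclotomic_zpExtension 2
  set κ₀ := κ.restrict K h with hκ₀
  have hκ₀c : κ₀.IsCyclotomic := isCyclotomic_restrict κ hcyc K h
  have hTR := totallyRamifiedFrom_zero_of_sq_eq_neg_of_mod_four_eq_one K hK2 hd4 hη κ₀ hκ₀c
  -- the layers
  set M' := ↥(κ₀.layer (n + 1))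
  set L' := ↥(κ₀.layer (n + (1 + 1)))
  haveI : FiniteDimensional K M' := κ₀.finiteDimensional_layer_holds _
  haveI : NumberField M' := NumberField.of_module_finite K _
  haveI : FiniteDimensional K L' := κ₀.finiteDimensional_layer_holds _
  haveI : NumberField L' := NumberField.of_module_finite K _
  have hML' : κ₀.layer (n + 1) ≤ κ₀.layer (n + (1 + 1)) := κ₀.layer_mono (by omega)
  letI : Algebra M' L' := (IntermediateField.inclusion hML').toRingHom.toAlgebra
  haveI : IsScalarTower K M' L' := IsScalarTower.of_algebraMap_eq fun x => ((IntermediateField.inclusion hML').commutes x).symm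
  haveI : FiniteDimensional M' L' := Module.Finite.of_restrictScalars_finite K M' L'
  haveI : IsGalois M' L' := isGalois_layer_layer κ₀
  -- the X-model and the isomorphisms
  set j := absEmbedding ℚ K with hj
  haveI : NumberField ↥(j.fieldRange ⊔ κ.layer (n + 1)) := numberField_fieldRange_sup_layer κ K j (n + 1)
  haveI : NumberField ↥(j.fieldRange ⊔ κ.layer (n + 2)) := numberField_fieldRange_sup_layer κ K j (n + 2)
  letI : Algebra ↥(j.fieldRange ⊔ κ.layer (n + 1)) ↥(j.fieldRange ⊔ κ.layer (n + 2)) :=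
    (IntermediateField.inclusion (sup_le_sup_left (κ.layer_mono (by omega)) _)).toRingHom.toAlgebra
  obtain ⟨eM, eL, hcomp⟩ := exists_ringEquiv_fieldRange_sup_layer_pair K h n
  obtain ⟨𝔓M, h2M, -, -⟩ := exists_dyadic_prime_fieldRange_sup_layer hcyc K hK2 hd4 hη (n + 1)
  obtain ⟨𝔓L, h2L, -, -⟩ := exists_dyadic_prime_fieldRange_sup_layer hcyc K hK2 hd4 hη (n + 2)
  obtain ⟨hker, -, -⟩ := dyadicCapitulation_fieldRange_sup_layer hcyc K hK2 hsf hd4 hd1 hη n 𝔓M h2M 𝔓L h2L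
  -- the dyadic prime of `M'`
  obtain ⟨P', hP'max, -, -, h2P', huniqP'⟩ := exists_dyadic_prime_layer K hK2 hd4 hη κ₀ hκ₀c (n + 1)
  haveI := hP'max
  have hP'0 : P' ≠ ⊥ := Ring.ne_bot_of_isMaximal_of_not_isField hP'max (RingOfIntegers.not_isField M')
  set 𝔓' : HeightOneSpectrum (𝓞 M') := ⟨P', hP'max.isPrime, hP'0⟩
  have huniq' : ∀ Q : HeightOneSpectrum (𝓞 M'), (2 : 𝓞 M') ∈ Q.asIdeal → Q = 𝔓' := fun Q hQ => by
    haveI := Q.isMaximal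
    exact HeightOneSpectrum.ext (huniqP' Q.asIdeal hQ)
  have hker' : ∀ c : ClassGroup (𝓞 M'), classGroupExtend M' L' c = 1 → c = 1 ∨ c = ClassGroup.mk0 ⟨𝔓'.asIdeal, mem_nonZeroDivisors_of_ne_zero 𝔓'.ne_bot⟩ :=
    fun c hc => eq_one_or_eq_mk0_of_classGroupExtend_eq_one_of_ringEquiv eM eL hcomp 𝔓M h2M hker 𝔓' huniq' hc
  -- the norm is onto above the Fukuda index; `#Gal(L'/M') = 2`
  have hN : Function.Surjective (classGroupNorm M' L') := classGroupNorm_layer_succ_succ_surjective κ₀ (hTR.mono (Nat.zero_le n))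
  have hcard : Fintype.card (L' ≃ₐ[M'] L') = 2 := by
    rw [← Nat.card_eq_fintype_card, card_aut_layer_layer κ₀ (show n + 1 ≤ n + (1 + 1) by omega)]
    simp
  have hle := DyadicCapitulation.padicValNat_card_add_le_succ (classGroupNorm M' L') (classGroupExtend M' L')
    (fun σ : L' ≃ₐ[M'] L' => (ClassGroup.mulEquiv (AmbiguousClass.intAut σ)).toMonoidHom) hN _ hker'
    (fun σ c => classGroupNorm_galois_smul M' L' σ c) (fun c => classGroupExtend_classGroupNorm_eq_prod M' L' c) (by rw [hcard])
  rw [classNumberPExp_def, classNumberPExp_def, classGroupPRank_def]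
  exact hle

/-! ## §4 `rank₂ Cl(K_m) ≤ λ₂ + 1` for `m ≫ 0`, every cyclotomic `ℤ₂`-extension -/

/-- ★ **`rank₂ Cl(K_m) ≤ classicalLambda κK + 1` for all `m ≫ 0`**, for every cyclotomic `ℤ₂`-extension `κK` of `K ∋ √−d`, `d ≡ 1 (mod 4)` squarefree, `d ≠ 1`
(and `μ = 0`): under `μ = 0` (tree `classicalMuVanishes_imaginaryQuadratic_cyclotomic_two`) the differences `e_{m+1} − e_m` are eventually `λ`, and §3 gives
`e_{m+1} − e_m ≥ r_m − 1`; all cyclotomic `κK` have the same `e_m`, `r_m`, `λ`.  With the tree's unconditional `λ ≤ rank₂ Cl(K_m)` (`m ≫ 0`): the eventual `2`-rank `r`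
satisfies `r − 1 ≤ λ₂ ≤ r` (Ferrero 1980 / Kida 1979: `λ₂ = r − 1`, the Iwasawa module having the finite submodule `ℤ/2` generated by the dyadic classes).
[cite: Ferrero1980AJM, §3] [cite: Kida1979Tohoku, Thm. 1] [cite: Washington1997, §13.3 Thm. 13.13 and Prop. 13.28] -/
theorem exists_forall_classGroupPRank_le_classicalLambda_add_one (hK2 : Module.finrank ℚ K = 2) {d : ℕ} (hsf : Squarefree d) (hd4 : d % 4 = 1)
    (hd1 : d ≠ 1) (hη : ∃ η : K, η ^ 2 = -((d : ℕ) : K)) (κK : ZpExtension K 2) (hκK : κK.IsCyclotomic) :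
    ClassicalMuVanishes κK ∧ ∃ m₀ : ℕ, ∀ m, m₀ ≤ m → classGroupPRank κK m ≤ classicalLambda κK + 1 := by
  haveI : Fact (Nat.Prime 2) := ⟨Nat.prime_two⟩
  have hIQ := isImaginaryQuadratic_of_sq_eq_neg K hK2 (by omega) hη
  set κ := CyclotomicZp.zpExtension 2 with hκdef
  have hcyc : κ.IsCyclotomic := CyclotomicZp.isCyclotomic_zpExtension 2
  have hsurj := surjective_comp_absGaloisRestrict_imaginaryQuadratic_two hcyc K hIQ
  set κ₀ := κ.restrict K hsurj with hκ₀
  have hκ₀c : κ₀.IsCyclotomic := isCyclotomic_restrict κ hcyc K hsurj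
  have hμ₀ : ClassicalMuVanishes κ₀ := classicalMuVanishes_imaginaryQuadratic_cyclotomic_two K hIQ κ₀ hκ₀c
  have hμ : ClassicalMuVanishes κK := classicalMuVanishes_imaginaryQuadratic_cyclotomic_two K hIQ κK hκK
  refine ⟨hμ, ?_⟩
  obtain ⟨n₂, hn₂⟩ := classNumberPExp_succ_sub_eq_classicalLambda κ₀ hμ₀
  refine ⟨n₂ + 1, fun m hm => ?_⟩
  obtain ⟨n, rfl⟩ : ∃ n, m = n + 1 := ⟨m - 1, by omega⟩
  have h1 := classNumberPExp_add_classGroupPRank_le_succ_of_sq_eq_neg K hK2 hsf hd4 hd1 hη hsurj n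
  have h2 := hn₂ (n + 1) (by omega)
  have h3 : (classNumberPExp κ₀ (n + 1) : ℤ) + classGroupPRank κ₀ (n + 1) ≤ classNumberPExp κ₀ (n + 1 + 1) + 1 := by exact_mod_cast h1
  have h4 : (classGroupPRank κ₀ (n + 1) : ℤ) ≤ classicalLambda κ₀ + 1 := by linarith
  rw [CoatesSujatha2005.classGroupPRank_eq_of_isCyclotomic κK κ₀ hκK hκ₀c, classicalLambda_eq_of_isCyclotomic κK κ₀ hκK hκ₀c]
  exact_mod_cast h4

end Tower

end Literature.NumberTheory.IwasawaTheory

end
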